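import Literature.Probability.LatticeModels.SpinPercolationEvents
import Literature.Probability.LatticeModels.GibbsStrongMarkov
import Literature.Probability.LatticeModels.IsingStateIdentification
import Literature.Probability.LatticeModels.IsingConsistency
import Literature.Probability.LatticeModels.IsingVolumeMonotonicity
import Literature.Probability.LatticeModels.IsingGibbsFlip
import HarnessLib

/-!
# No `+` percolation forces the minus state (Georgii–Higuchi 2000, Lemma 2.1)

Topic `Probability/LatticeModels`; theorems only. Georgii–Higuchi, *Percolation and number of
phases in the two-dimensional Ising model*, J. Math. Phys. 41 (2000), Lemma 2.1 (p. 4):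
"**If `μ ∈ 𝒢` is different from `μ⁻`, there exists with positive probability an infinite
`+`cluster.** That is, `μ(E⁺) > 0` when `μ ≠ μ⁻`." We prove the contrapositive
`μ(E⁺) = 0 ⇒ μ = μ⁻` (as equality of all correlations with `⟨σ_A⟩⁻_{β,h}`,
`spinCorr_eq_minusCorr_of_existsInfCluster_null`) for the nearest-neighbour Ising model on `ℤ^d`,
any `d`, `β ≥ 0` and any field `h` — the printed proof uses no planarity — together with the
positive form `measure_existsInfCluster_pos_of_spinCorr_ne_minusCorr` and, at zero field, the
`±`-interchanged form `spinCorr_eq_plusCorr_of_existsInfCluster_neg_null` (via the global spin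
flip, `IsingGibbsFlip`).

## The proof (Georgii–Higuchi 2000, pp. 4–5), with the exploration volume for the circuit

Printed: "Suppose that `μ(E⁺) = 0`. Then any given square `Δ` is almost surely surrounded by a
`-∗`circuit, and with probability close to `1` such a circuit can already be found within a square
`Λ ⊃ Δ` provided `Λ` is large enough. If this occurs, we let `Γ` be the largest random subset of
`Λ` which is the interior of such a `-∗`circuit … By maximality, `Γ` is determined from outside.
The strong Markov property together with the stochastic monotonicity `μ⁻_Γ ≼ μ⁻` therefore implies
(in the limit `Λ ↑ ℤ²`) that `μ ≼ μ⁻` on `𝓕_Δ`. Since `Δ` was arbitrary and `μ⁻` is minimal we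
find that `μ = μ⁻`." Here `Γ = Γ_n(ω)` is the exploration volume `explVolume 𝕃^d B(n) S⁺(ω)`
(`ExplorationVolume`, `SpinPercolationEvents`): it is determined from outside, its outer boundary
is `-`, and `Δ ⊆ Γ_n(ω)` as soon as no `+`path joins the neighbourhood of `Δ` to `∂ⁱⁿB(n)`;
since `μ(E⁺) = 0` this fails with probability `→ 0` (`tendsto_measure_not_subset_explVolume`).
On `{Δ ⊆ Γ_n}`, `γ_{Γ_n}(f|ω) = μ⁻_{Γ_n}(f) ≤ μ⁻_{B(N)}(f) → ⟨f⟩⁻` (locality in the boundary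
condition, volume monotonicity for `-` boundary conditions, Friedli–Velenik 2017, Lemma 3.22),
so the strong Markov property (`GibbsStrongMarkov`) gives `μ(f) ≤ ⟨f⟩⁻ μ(Δ ⊆ Γ_n) + C μ(Δ ⊄ Γ_n)
→ ⟨f⟩⁻` for nondecreasing local `f`, and minimality of `μ⁻` (`IsingStateIdentification`)
concludes.

## References

* H.-O. Georgii, Y. Higuchi, J. Math. Phys. 41 (2000) 1153–1169, Lemma 2.1, pp. 4–5
  [GeorgiiHiguchi2000].
* S. Friedli, Y. Velenik, *Statistical Mechanics of Lattice Systems*, CUP 2017, Lemma 3.22,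
  §3.6.3 (locality) [FriedliVelenik2017].
-/

noncomputable section

open MeasureTheory Filter Topology Finset
open Literature.Probability.Percolation (siteCluster sitePercolatesAt siteOpenGraph siteOpenGraph_mono)

namespace Literature.Probability.LatticeModels

variable {d : ℕ}

/-! ### A cluster meeting the boundaries of infinitely many boxes is infinite -/

/-- The inner boundaries of distinct centred boxes of `ℤ^d` are disjoint: a common site would have
a coordinate of modulus `n` and all coordinates of modulus `≤ m`, and vice versa. [folklore] -/
theorem eq_of_mem_innerBoundary_box {n m : ℕ} {x : Site d}
    (hn : x ∈ innerBoundary (zdGraph d) (box d n)) (hm : x ∈ innerBoundary (zdGraph d) (box d m)) :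
    n = m := by
  obtain ⟨i, hi⟩ := Percolation.exists_eq_of_mem_innerBoundary_box hn
  obtain ⟨j, hj⟩ := Percolation.exists_eq_of_mem_innerBoundary_box hm
  have hxn := mem_box.1 (mem_innerBoundary_iff.1 hn).1
  have hxm := mem_box.1 (mem_innerBoundary_iff.1 hm).1
  have h1 := hxm i
  have h2 := hxn j
  omega

/-- A set of sites meeting the inner boundaries `∂ⁱⁿB(n)` of infinitely many centred boxes is
infinite (the boundaries are pairwise disjoint). [folklore] -/
theorem Set.infinite_of_frequently_mem_innerBoundary_box {C : Set (Site d)}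
    (h : ∃ᶠ n in atTop, ∃ x ∈ C, x ∈ innerBoundary (zdGraph d) (box d n)) : C.Infinite := by
  rw [Nat.frequently_atTop_iff_infinite] at h
  set N : Set ℕ := {n | ∃ x ∈ C, x ∈ innerBoundary (zdGraph d) (box d n)} with hN
  haveI : Infinite N := h.to_subtype
  have hch : ∀ n : N, ∃ x ∈ C, x ∈ innerBoundary (zdGraph d) (box d n) := fun n => n.2
  choose f hfC hfb using hch
  refine Set.infinite_of_injective_forall_mem (f := f) (fun n m hnm => ?_) hfC
  exact Subtype.ext (eq_of_mem_innerBoundary_box (hfb n) (hnm ▸ hfb m))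

/-! ### The neighbourhood of `Δ` is enclosed by the exploration volume with high probability -/

section Enclosure

variable {β h : ℝ}

/-- The event `{Δ ⊆ Γ_n}` that the exploration volume of the `+` spins in the box `B(n)` contains
`Δ` is measurable (a finite union of the events `{Γ_n = S}`). [cite: GeorgiiHiguchi2000, Lemma 2.1 (proof, pp. 4–5)] -/
theorem measurableSet_subset_explVolume (Δ : Finset (Site d)) (n : ℕ) :
    MeasurableSet {ω : SpinConfig (Site d) |
      Δ ⊆ explVolume (zdGraph d) (box d n) (spinSites 1 ω)} := by
  have hU : {ω : SpinConfig (Site d) | Δ ⊆ explVolume (zdGraph d) (box d n) (spinSites 1 ω)} =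
      ⋃ S ∈ (box d n).powerset.filter (fun S => Δ ⊆ S),
        {ω | explVolume (zdGraph d) (box d n) (spinSites 1 ω) = S} := by
    ext ω
    simp only [Set.mem_setOf_eq, Set.mem_iUnion, Finset.mem_filter, Finset.mem_powerset,
      exists_prop]
    constructor
    · intro hΔ
      exact ⟨_, ⟨explVolume_subset _ _, hΔ⟩, rfl⟩
    · rintro ⟨S, ⟨-, hΔS⟩, hS⟩
      rwa [hS]
  rw [hU]
  refine Finset.measurableSet_biUnion _ fun S _ => ?_
  exact cylinderEvents_le_pi _ (measurableSet_explVolume_spinSites_eq (box d n) S)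

/-- The events `{Δ ⊆ Γ_n}` increase with `n` (`explVolume_mono_volume`). [cite: GeorgiiHiguchi2000, Lemma 2.1 (proof, pp. 4–5)] -/
theorem monotone_subset_explVolume (Δ : Finset (Site d)) :
    Monotone fun n => {ω : SpinConfig (Site d) |
      Δ ⊆ explVolume (zdGraph d) (box d n) (spinSites 1 ω)} :=
  fun _ _ hnm _ hω => hω.trans (explVolume_mono_volume (box_mono d hnm) _)

/-- **If no site near `Δ` percolates, `Δ` is eventually enclosed**: a configuration for which
`Δ ⊄ Γ_n(ω)` for all `n` has an infinite `+`cluster at a site of `Δ` or adjacent to `Δ`. Indeed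
some `y ∈ Δ` is never enclosed (the events increase in `n`); for each large `n` a `+`neighbour of
`y` is joined by `+` sites to `∂ⁱⁿB(n)` (`exists_reachable_innerBoundary_of_not_mem_explVolume`);
one of the finitely many neighbours serves infinitely often, and its `+`cluster meets infinitely
many disjoint box boundaries (Georgii–Higuchi 2000, proof of Lemma 2.1: under `μ(E⁺) = 0`, "with
probability close to `1` such a circuit can already be found within a square `Λ ⊃ Δ` provided
`Λ` is large enough"). [cite: GeorgiiHiguchi2000, Lemma 2.1 (proof, pp. 4–5)] -/
theorem iInter_not_subset_explVolume_subset (Δ : Finset (Site d)) :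
    (⋂ n, {ω : SpinConfig (Site d) | Δ ⊆ explVolume (zdGraph d) (box d n) (spinSites 1 ω)}ᶜ) ⊆
      ⋃ t ∈ Δ ∪ Δ.biUnion (fun y => (zdGraph d).neighborFinset y),
        {ω | spinSites 1 ω ∈ sitePercolatesAt (zdGraph d) t} := by
  intro ω hω
  simp only [Set.mem_iInter, Set.mem_compl_iff, Set.mem_setOf_eq] at hω
  -- a box containing `Δ` and all its neighbours
  set K : Finset (Site d) := Δ ∪ Δ.biUnion (fun y => (zdGraph d).neighborFinset y) with hK
  obtain ⟨n₀, hn₀⟩ := (eventually_subset_box_holds (d := d) K).exists_forall_of_atTop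
  -- some `y ∈ Δ` is never enclosed from `n₀` on
  have hy : ∃ y ∈ Δ, ∀ n, n₀ ≤ n → y ∉ explVolume (zdGraph d) (box d n) (spinSites 1 ω) := by
    by_contra hall
    push Not at hall
    choose! N hN hNmem using hall
    have hsub : Δ ⊆ explVolume (zdGraph d) (box d (Δ.sup N + n₀)) (spinSites 1 ω) := by
      intro y hyΔ
      have h1 := hNmem y hyΔ
      exact explVolume_mono_volume (box_mono d ((Finset.le_sup hyΔ).trans (Nat.le_add_right _ _)))
        _ h1
    exact hω _ hsub
  obtain ⟨y, hyΔ, hy⟩ := hy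
  have hyK : y ∈ K := Finset.mem_union_left _ hyΔ
  -- for each `n ≥ n₀`: a `+` neighbour `t` of `y` whose `+`cluster meets `∂ⁱⁿB(n)`
  have hstep : ∀ n, n₀ ≤ n → ∃ t ∈ (zdGraph d).neighborFinset y,
      ∃ t' ∈ siteCluster (zdGraph d) (spinSites 1 ω) t, t' ∈ innerBoundary (zdGraph d) (box d n) := by
    intro n hn
    have hyΛ : y ∈ box d n := hn₀ n hn hyK
    have hfar : ∀ z, (zdGraph d).Adj y z → z ∈ box d n := fun z hz =>
      hn₀ n hn (Finset.mem_union_right _ (Finset.mem_biUnion.2 ⟨y, hyΔ,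
        (SimpleGraph.mem_neighborFinset _ _ _).2 hz⟩))
    obtain ⟨t, t', ht, -, hadj, ht', ht'b, hreach⟩ :=
      exists_reachable_innerBoundary_of_not_mem_explVolume hyΛ (hy n hn) hfar
    refine ⟨t, (SimpleGraph.mem_neighborFinset _ _ _).2 hadj, t', ⟨ht, ht', ?_⟩, ht'b⟩
    exact hreach.mono (siteOpenGraph_mono (zdGraph d) Set.inter_subset_left)
  -- one neighbour serves for infinitely many `n`
  have hfreq : ∃ t ∈ (zdGraph d).neighborFinset y, ∃ᶠ n in atTop,
      ∃ t' ∈ siteCluster (zdGraph d) (spinSites 1 ω) t, t' ∈ innerBoundary (zdGraph d) (box d n) := by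
    by_contra hnone
    push Not at hnone
    -- each neighbour serves only finitely often, so all together only finitely often
    have hfin : ∀ᶠ n in atTop, ∀ t ∈ (zdGraph d).neighborFinset y,
        ¬ ∃ t' ∈ siteCluster (zdGraph d) (spinSites 1 ω) t, t' ∈ innerBoundary (zdGraph d) (box d n) := by
      rw [eventually_all_finset]
      intro t ht
      filter_upwards [hnone t ht] with n hn
      push Not
      exact hn
    obtain ⟨n, hn, hn'⟩ := (hfin.and (eventually_ge_atTop n₀)).exists
    obtain ⟨t, ht, ht'⟩ := hstep n hn'
    exact hn t ht ht'
  obtain ⟨t, ht, hfr⟩ := hfreq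
  refine Set.mem_iUnion₂.2 ⟨t, Finset.mem_union_right _ (Finset.mem_biUnion.2 ⟨y, hyΔ, ht⟩), ?_⟩
  exact Set.infinite_of_frequently_mem_innerBoundary_box hfr

/-- **Under `μ(E⁺) = 0` the exploration volume eventually encloses `Δ` in probability**:
`μ(Δ ⊄ Γ_n) → 0` (Georgii–Higuchi 2000, proof of Lemma 2.1, the step quoted in
`iInter_not_subset_explVolume_subset`; continuity of `μ` along the decreasing events
`{Δ ⊄ Γ_n}`, whose intersection is `μ`-null). [cite: GeorgiiHiguchi2000, Lemma 2.1 (proof, pp. 4–5)] -/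
theorem tendsto_measure_not_subset_explVolume (μ : Measure (SpinConfig (Site d)))
    [IsFiniteMeasure μ] (hE : μ (existsInfCluster (zdGraph d) 1) = 0) (Δ : Finset (Site d)) :
    Tendsto (fun n => μ {ω : SpinConfig (Site d) |
      Δ ⊆ explVolume (zdGraph d) (box d n) (spinSites 1 ω)}ᶜ) atTop (𝓝 0) := by
  have hanti : Antitone fun n => {ω : SpinConfig (Site d) |
      Δ ⊆ explVolume (zdGraph d) (box d n) (spinSites 1 ω)}ᶜ :=
    fun n m hnm => Set.compl_subset_compl.2 (monotone_subset_explVolume Δ hnm)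
  have hnull : μ (⋂ n, {ω : SpinConfig (Site d) |
      Δ ⊆ explVolume (zdGraph d) (box d n) (spinSites 1 ω)}ᶜ) = 0 := by
    refine measure_mono_null (iInter_not_subset_explVolume_subset Δ) ?_
    refine measure_mono_null (Set.iUnion₂_subset fun t _ ω hω => ?_) hE
    exact mem_existsInfCluster_of_infinite hω
  have h := tendsto_measure_iInter_atTop (μ := μ)
    (fun n => ((measurableSet_subset_explVolume Δ n).compl).nullMeasurableSet) hanti
    ⟨0, measure_ne_top _ _⟩
  rwa [hnull] at h

end Enclosure

/-! ### Inside the exploration volume the conditional law is dominated by the minus state -/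

section Conditional

variable {β h : ℝ}

/-- **`γ_Γ(f|ω) = μ⁻_Γ(f) ≤ ⟨f⟩⁻` on `{Δ ⊆ Γ}`** (Georgii–Higuchi 2000, proof of Lemma 2.1: "the
stochastic monotonicity `μ⁻_Γ ≼ μ⁻`"): for `β ≥ 0`, a nondecreasing measurable `f` depending on
the spins in `Δ ⊆ Γ_n(ω)`, the finite-volume expectation in the exploration volume with boundary
condition `ω` equals the one with `-` boundary condition (the outer boundary of `Γ_n(ω)` is `-`;
locality, Friedli–Velenik 2017, §3.6.3) and is at most `μ⁻_{B(N)}(f)` for `N ≥ n` (volume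
monotonicity for `-` boundary conditions, Friedli–Velenik 2017, Lemma 3.22), hence at most the
limit `⟨f⟩⁻_{β,h}`. [cite: GeorgiiHiguchi2000, Lemma 2.1 (proof, pp. 4–5)] -/
theorem isingExpect_explVolume_le_minusExpect (hβ : 0 ≤ β) {Δ : Finset (Site d)}
    {f : SpinConfig (Site d) → ℝ} (hf : Monotone f) (hfm : Measurable f)
    (hfD : DependsOn f (↑Δ : Set (Site d))) (n : ℕ) (ω : SpinConfig (Site d))
    (hΔ : Δ ⊆ explVolume (zdGraph d) (box d n) (spinSites 1 ω)) :
    isingExpect (zdGraph d) (explVolume (zdGraph d) (box d n) (spinSites 1 ω)) β h (.fixed ω) f ≤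
      minusExpect d β h f := by
  set Γ := explVolume (zdGraph d) (box d n) (spinSites 1 ω) with hΓ
  -- locality: only the (all `-`) outer boundary of `Γ` matters
  have hη : ∀ y ∈ outerBoundary (zdGraph d) Γ, ω y = (-1 : SpinConfig (Site d)) y := fun y hy =>
    eq_neg_one_of_mem_outerBoundary_explVolume (box d n) ω hy
  have hF : ∀ σ σ' : SpinConfig (Site d), (∀ x ∈ Γ, σ x = σ' x) → f σ = f σ' :=
    fun σ σ' hσ => hfD fun x hx => hσ x (hΔ (Finset.mem_coe.1 hx))
  rw [isingExpect_fixed_congr_outerBoundary (zdGraph d) hη β h hfm hF]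
  -- volume monotonicity for the `-` boundary condition, then the box limit
  have hmono : ∀ N, n ≤ N → isingExpect (zdGraph d) Γ β h (.fixed (-1)) f ≤
      isingExpect (zdGraph d) (box d N) β h .minus f := fun N hN =>
    isingExpect_fixed_mono_volume (zdGraph d) hβ ((explVolume_subset _ _).trans (box_mono d hN)) h
      (η := -1) (fun _ _ => rfl) hf hfm
  exact ge_of_tendsto (tendsto_isingExpect_minus_box hβ h hf hfm) (eventually_atTop.2 ⟨n, hmono⟩)

end Conditional

/-! ### Lemma 2.1 -/

section Lemma21

variable {β h : ℝ}

/-- For a probability measure `ν` and `|f| ≤ C`: `∫ f dν + C = (∫⁻ (f + C) dν).toReal` (the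
nonnegative shift used to transport measurability from `ℝ≥0∞`-valued integrals). [folklore] -/
theorem integral_add_eq_toReal_lintegral {Ω : Type*} [MeasurableSpace Ω] (ν : Measure Ω)
    [IsProbabilityMeasure ν] {f : Ω → ℝ} (hfm : Measurable f) {C : ℝ} (hC : ∀ x, |f x| ≤ C) :
    ∫ x, f x ∂ν + C = (∫⁻ x, ENNReal.ofReal (f x + C) ∂ν).toReal := by
  have hfi : Integrable f ν := (integrable_const C).mono' hfm.aestronglyMeasurable
    (ae_of_all _ fun x => by rw [Real.norm_eq_abs]; exact hC x)
  have hC0 : ∀ x, 0 ≤ f x + C := fun x => by linarith [neg_abs_le (f x), hC x]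
  have h1 : ∫ x, f x + C ∂ν = ∫ x, f x ∂ν + C := by
    rw [integral_add hfi (integrable_const C), integral_const, smul_eq_mul, probReal_univ, one_mul]
  rw [← h1, integral_eq_lintegral_of_nonneg_ae (ae_of_all _ hC0) (hfm.add_const C).aestronglyMeasurable]

/-- **`μ(f) ≤ ⟨f⟩⁻` for nondecreasing local `f` when `μ(E⁺) = 0`** (Georgii–Higuchi 2000, proof
of Lemma 2.1: "`μ ≼ μ⁻` on `𝓕_Δ`"): the strong Markov property for the exploration volume `Γ_n`
(`IsGibbsMeasure.integral_strongMarkov`) gives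
`μ(f) = ∫ γ_{Γ_n(ω)}(f|ω) μ(dω) ≤ ⟨f⟩⁻ μ(Δ ⊆ Γ_n) + C μ(Δ ⊄ Γ_n)`, and `μ(Δ ⊄ Γ_n) → 0`. [cite: GeorgiiHiguchi2000, Lemma 2.1 (proof, pp. 4–5)] -/
theorem integral_le_minusExpect_of_existsInfCluster_null (hβ : 0 ≤ β)
    {μ : Measure (SpinConfig (Site d))} (hμ : μ ∈ isingGibbsMeasures d β h)
    (hE : μ (existsInfCluster (zdGraph d) 1) = 0) {f : SpinConfig (Site d) → ℝ} (hf : Monotone f)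
    (hfm : Measurable f) {Δ : Finset (Site d)} (hfD : DependsOn f (↑Δ : Set (Site d))) {C : ℝ}
    (hC : ∀ σ, |f σ| ≤ C) :
    ∫ σ, f σ ∂μ ≤ minusExpect d β h f := by
  set γ := isingSpecification (zdGraph d) β h with hγdef
  have hγ : IsSpecification γ := isSpecification_isingSpecification_zd_holds d β h
  have hμG : IsGibbsMeasure γ μ := hμ
  haveI := hμG.isProbabilityMeasure
  have hprob : ∀ (Λ : Finset (Site d)) (η : SpinConfig (Site d)), IsProbabilityMeasure (γ Λ η) :=
    fun Λ η => hγ.isProbability Λ η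
  -- the random volumes, their events and conditional expectations
  let Γ : ℕ → SpinConfig (Site d) → Finset (Site d) :=
    fun n ω => explVolume (zdGraph d) (box d n) (spinSites 1 ω)
  let A : ℕ → Set (SpinConfig (Site d)) := fun n => {ω | Δ ⊆ Γ n ω}
  let F : ℕ → SpinConfig (Site d) → ℝ := fun n ω => ∫ σ, f σ ∂(γ (Γ n ω) ω)
  have hA : ∀ n, MeasurableSet (A n) := fun n => measurableSet_subset_explVolume Δ n
  have hΓ : ∀ n (S : Finset (Site d)), MeasurableSet[cylinderEvents (X := fun _ : Site d => ℤˣ)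
      ((↑S : Set (Site d))ᶜ)] {ω | Γ n ω = S} := fun n S =>
    measurableSet_explVolume_spinSites_eq (box d n) S
  -- strong Markov property: `μ(f) = ∫ F_n dμ`
  have hSM : ∀ n, ∫ σ, f σ ∂μ = ∫ ω, F n ω ∂μ := fun n =>
    hμG.integral_strongMarkov hγ (hΓ n) hfm hC
  -- `|F_n| ≤ C`, `F_n` measurable, integrable
  have hFb : ∀ n ω, |F n ω| ≤ C := fun n ω => by
    haveI := hprob (Γ n ω) ω
    have h1 : ‖∫ σ, f σ ∂(γ (Γ n ω) ω)‖ ≤ C * (γ (Γ n ω) ω).real Set.univ :=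
      norm_integral_le_of_norm_le_const (ae_of_all _ fun σ => by
        rw [Real.norm_eq_abs]; exact hC σ)
    rwa [probReal_univ, mul_one, Real.norm_eq_abs] at h1
  have hFm : ∀ n, Measurable (F n) := by
    intro n
    have hΓm : ∀ S : Finset (Site d), MeasurableSet {ω | Γ n ω = S} := fun S =>
      cylinderEvents_le_pi _ (hΓ n S)
    have hG : Measurable fun ω => ∫⁻ σ, ENNReal.ofReal (f σ + C) ∂(γ (Γ n ω) ω) :=
      hγ.measurable_lintegral_randomVolume hΓm (hfm.add_const C).ennreal_ofReal
    have hFeq : F n = fun ω => (∫⁻ σ, ENNReal.ofReal (f σ + C) ∂(γ (Γ n ω) ω)).toReal - C := by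
      funext ω
      haveI := hprob (Γ n ω) ω
      have := integral_add_eq_toReal_lintegral (γ (Γ n ω) ω) hfm hC
      change ∫ σ, f σ ∂(γ (Γ n ω) ω) = _
      linarith
    rw [hFeq]
    exact hG.ennreal_toReal.sub_const C
  have hFi : ∀ n, Integrable (F n) μ := fun n =>
    (integrable_const C).mono' (hFm n).aestronglyMeasurable
      (ae_of_all _ fun ω => by rw [Real.norm_eq_abs]; exact hFb n ω)
  -- on `A_n`: `F_n ≤ ⟨f⟩⁻`
  have hFle : ∀ n, ∀ ω ∈ A n, F n ω ≤ minusExpect d β h f := fun n ω hω =>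
    isingExpect_explVolume_le_minusExpect hβ hf hfm hfD n ω hω
  -- the bound `μ(f) ≤ ⟨f⟩⁻ μ(A_n) + C μ(A_nᶜ)`
  have hbound : ∀ n, ∫ σ, f σ ∂μ ≤
      minusExpect d β h f * μ.real (A n) + C * μ.real (A n)ᶜ := by
    intro n
    rw [hSM n, ← integral_add_compl (hA n) (hFi n)]
    refine add_le_add ?_ ?_
    · calc ∫ ω in A n, F n ω ∂μ ≤ ∫ _ in A n, minusExpect d β h f ∂μ :=
            setIntegral_mono_on (hFi n).integrableOn (integrableOn_const) (hA n) (hFle n)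
        _ = minusExpect d β h f * μ.real (A n) := by
            rw [setIntegral_const, smul_eq_mul, mul_comm]
    · calc ∫ ω in (A n)ᶜ, F n ω ∂μ ≤ ∫ _ in (A n)ᶜ, C ∂μ :=
            setIntegral_mono_on (hFi n).integrableOn (integrableOn_const) (hA n).compl
              fun ω _ => (le_abs_self _).trans (hFb n ω)
        _ = C * μ.real (A n)ᶜ := by
            rw [setIntegral_const, smul_eq_mul, mul_comm]
  -- the right-hand side tends to `⟨f⟩⁻`
  have hcompl : Tendsto (fun n => μ.real (A n)ᶜ) atTop (𝓝 0) := by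
    have h0 := tendsto_measure_not_subset_explVolume μ hE Δ
    have := (ENNReal.tendsto_toReal ENNReal.zero_ne_top).comp h0
    rw [ENNReal.toReal_zero] at this
    exact this
  have hAn : Tendsto (fun n => μ.real (A n)) atTop (𝓝 1) := by
    have heq : (fun n => μ.real (A n)) = fun n => 1 - μ.real (A n)ᶜ := by
      funext n
      have := probReal_compl_eq_one_sub (μ := μ) (hA n)
      linarith
    rw [heq]
    simpa using (tendsto_const_nhds (x := (1 : ℝ))).sub hcompl
  have hlim : Tendsto (fun n => minusExpect d β h f * μ.real (A n) + C * μ.real (A n)ᶜ) atTop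
      (𝓝 (minusExpect d β h f)) := by
    have := (hAn.const_mul (minusExpect d β h f)).add (hcompl.const_mul C)
    simpa using this
  exact ge_of_tendsto' hlim hbound

/-- **Georgii–Higuchi 2000, Lemma 2.1 (contrapositive form): if there is almost surely no
infinite `+`cluster, then `μ` is the minus state.** For the nearest-neighbour Ising model on
`ℤ^d` (any `d`), `β ≥ 0`, any field `h` and `μ ∈ 𝒢(β, h)` with `μ(E⁺) = 0`, all correlations of
`μ` are those of `⟨·⟩⁻_{β,h}`: `μ(f) ≤ ⟨f⟩⁻` for nondecreasing local `f`
(`integral_le_minusExpect_of_existsInfCluster_null`) and `μ⁻` is minimal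
(`spinCorr_eq_minusCorr_of_forall_integral_le_minusExpect`). [cite: GeorgiiHiguchi2000, Lemma 2.1] -/
theorem spinCorr_eq_minusCorr_of_existsInfCluster_null (hβ : 0 ≤ β)
    {μ : Measure (SpinConfig (Site d))} (hμ : μ ∈ isingGibbsMeasures d β h)
    (hE : μ (existsInfCluster (zdGraph d) 1) = 0) :
    ∀ A : Finset (Site d), spinCorr μ A = minusCorr d β h A :=
  spinCorr_eq_minusCorr_of_forall_integral_le_minusExpect hβ hμ
    fun _ hf hfm ⟨_, hΔ⟩ ⟨_, hC⟩ =>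
      integral_le_minusExpect_of_existsInfCluster_null hβ hμ hE hf hfm hΔ hC

/-- **Georgii–Higuchi 2000, Lemma 2.1 (Existence of infinite clusters)**: "If `μ ∈ 𝒢` is
different from `μ⁻`, there exists with positive probability an infinite `+`cluster. That is,
`μ(E⁺) > 0` when `μ ≠ μ⁻`" — for the nearest-neighbour Ising model on `ℤ^d`, `β ≥ 0`, any `h`,
with "`μ ≠ μ⁻`" expressed as "some correlation of `μ` differs from `⟨σ_A⟩⁻_{β,h}`". [cite: GeorgiiHiguchi2000, Lemma 2.1] -/
theorem measure_existsInfCluster_pos_of_spinCorr_ne_minusCorr (hβ : 0 ≤ β)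
    {μ : Measure (SpinConfig (Site d))} (hμ : μ ∈ isingGibbsMeasures d β h)
    (hne : ∃ A : Finset (Site d), spinCorr μ A ≠ minusCorr d β h A) :
    0 < μ (existsInfCluster (zdGraph d) 1) := by
  rw [pos_iff_ne_zero]
  intro hE
  obtain ⟨A, hA⟩ := hne
  exact hA (spinCorr_eq_minusCorr_of_existsInfCluster_null hβ hμ hE A)

end Lemma21

/-! ### The spin-flipped statement at zero field -/

section Flip

variable {β : ℝ}

/-- `S⁺(-ω) = S⁻(ω)`: the `+` sites of the flipped configuration are the `-` sites. [cite: GeorgiiHiguchi2000, §2 p. 4] -/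
theorem spinSites_one_neg {V : Type*} (ω : SpinConfig V) : spinSites 1 (-ω) = spinSites (-1) ω := by
  ext x
  simp only [mem_spinSites, Pi.neg_apply]
  exact neg_eq_iff_eq_neg

/-- The flip maps `E⁻` onto `E⁺`: `flip⁻¹(E⁺) = E⁻`. [cite: GeorgiiHiguchi2000, §2 p. 4] -/
theorem preimage_neg_existsInfCluster_one {V : Type*} (G : SimpleGraph V) :
    (fun ω : SpinConfig V => -ω) ⁻¹' existsInfCluster G 1 = existsInfCluster G (-1) := by
  ext ω
  simp only [Set.mem_preimage, mem_existsInfCluster_iff, spinSites_one_neg]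

/-- **Georgii–Higuchi 2000, Lemma 2.1 with `+` and `-` interchanged** (p. 4: "By the symmetry
between the spin values `+1` and `-1`, these results also hold when `-` and `+` are
interchanged"): at zero field, for `β ≥ 0` and `μ ∈ 𝒢(β, 0)` on `ℤ^d`, if the event `E⁻` is
contained in a `μ`-null set (e.g. `μ(E⁻) = 0` once `E⁻` is known to be measurable), then all
correlations of `μ` are those of the plus state. Proof: the flipped measure is Gibbs
(`isGibbsMeasure_map_neg`) and has no `+` percolation, so it is the minus state; undo the flip
with `spinCorr_map_neg` and `minusCorr_eq_plusCorr_neg`. [cite: GeorgiiHiguchi2000, Lemma 2.1] -/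
theorem spinCorr_eq_plusCorr_of_existsInfCluster_neg_null (hβ : 0 ≤ β)
    {μ : Measure (SpinConfig (Site d))} (hμ : μ ∈ isingGibbsMeasures d β 0)
    (hE : μ (existsInfCluster (zdGraph d) (-1)) = 0) :
    ∀ A : Finset (Site d), spinCorr μ A = plusCorr d β 0 A := by
  have hμG : IsGibbsMeasure (isingSpecification (zdGraph d) β 0) μ := hμ
  haveI := hμG.isProbabilityMeasure
  set μ' : Measure (SpinConfig (Site d)) := μ.map fun σ => -σ with hμ'def
  have hμ' : μ' ∈ isingGibbsMeasures d β 0 := isGibbsMeasure_map_neg (zdGraph d) β hμG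
  have hE' : μ' (existsInfCluster (zdGraph d) 1) = 0 := by
    -- `μ'(E⁺) ≤ μ'(flip⁻¹ N) = μ(N) = 0` for a measurable null superset `N` of `E⁻`
    obtain ⟨N, hEN, hNm, hμN⟩ := exists_measurable_superset_of_null hE
    have hsub : existsInfCluster (zdGraph d) 1 ⊆ (fun σ : SpinConfig (Site d) => -σ) ⁻¹' N := by
      intro ω hω
      have : -ω ∈ existsInfCluster (zdGraph d) (-1) := by
        rw [← preimage_neg_existsInfCluster_one]
        simpa using hω
      exact hEN this
    refine measure_mono_null hsub ?_
    rw [hμ'def, Measure.map_apply measurable_neg (measurable_neg hNm)]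
    have : (fun σ : SpinConfig (Site d) => -σ) ⁻¹' ((fun σ => -σ) ⁻¹' N) = N := by
      ext ω; simp
    rw [this, hμN]
  intro A
  have h1 := spinCorr_eq_minusCorr_of_existsInfCluster_null hβ hμ' hE' A
  rw [hμ'def, spinCorr_map_neg, minusCorr_eq_plusCorr_neg hβ 0 A, neg_zero] at h1
  have hne : ((-1 : ℝ) ^ #A) ≠ 0 := pow_ne_zero _ (by norm_num)
  exact mul_left_cancel₀ hne h1

end Flip

end Literature.Probability.LatticeModels
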